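import Literature.Topology.FourManifolds.LatticeFormsNegTwoDVectorOrthogonalTwoElementary
import Literature.Topology.FourManifolds.LatticeFormsOrthogonalComplementInvariants
import Literature.Topology.FourManifolds.LatticeFormsTwoElementaryInvariants
import Literature.Topology.FourManifolds.LatticeFormsTwoElementaryParity
import Literature.Topology.FourManifolds.LatticeFormsEvenIndefiniteIsotropic
import Literature.Topology.FourManifolds.LatticeFormsTwoElementaryDiscriminantForm
import Literature.Topology.FourManifolds.LatticeFormsCodimOneSignature
import Literature.Topology.FourManifolds.LatticeFormsUnimodularSummand
import Literature.Topology.FourManifolds.LatticeFormsDefinite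
import Literature.Topology.FourManifolds.LatticeFormsMilnorClassification
import HarnessLib

/-!
# The orthogonal complement of a `(−2d)`-vector of `L_{2d}` with `div(r) ∈ {d, 2d}`
# (Gritsenko–Hulek–Sankaran, *The Kodaira dimension of the moduli of K3 surfaces*, §4 Prop. 4.6 of arXiv:math/0607339)

Trunk T-4MAN vocabulary; sequel of `LatticeFormsNegTwoDVectorOrthogonalTwoElementary.lean` (row g40-#3: the involution
`σ̃_r` and the `2`-elementarity of `L_r = {ℓ, r}^⊥` and `S_r = L_r^⊥`). Written for lane `lit-hodgefound` (Track 2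
foundations; prover seat `lit-hodgefound-p18`, gen 40, row g40-#4). THEOREMS ONLY — no definition, no named fact,
no instance, no notation.

Setting as in the predecessor: `Λ = (M, B)` even unimodular (for Prop. 4.6 proper: of rank `22` and signature `−16`,
i.e. the K3 lattice `L_{K3} = 3U ⊕ 2E₈(−1)` of signature `(3, 19)`), `ℓ ∈ Λ` primitive with `ℓ² = 2d > 0` (GHS's `h`,
so `ℓ^⊥ = L_{2d} = 2U ⊕ 2E₈(−1) ⊕ ⟨−2d⟩`), `r ∈ ℓ^⊥` primitive with `r² = −2d` and `d ∣ (r, w)` for all `w ∈ ℓ^⊥`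
(`div(r) ∈ {d, 2d}`); `L_r = r^⊥_{L_{2d}} = {ℓ, r}^⊥ = B.orthogonal (span ℤ {ℓ, r})`, `S_r = (L_r)^⊥`. The case
`div(r) = 2d` is `∀ w ⊥ ℓ, 2d ∣ (r, w)`; the case `div(r) = d` is its negation (given `d ∣ (r, ℓ^⊥)`).

## Source, verbatim (held text `paper:arxiv-math_0607339` p. 15, arXiv numbering §4)

"**Proposition 4.6.** Let `r` be a primitive vector of `L_{2d}`. If `div(r) = 2d` then `r^⊥_{L_{2d}} ≅ 2U ⊕ 2E₈(−1)`.
If `div(r) = d` then either `r^⊥_{L_{2d}} ≅ U ⊕ 2E₈(−1) ⊕ ⟨2⟩ ⊕ ⟨−2⟩` or `r^⊥_{L_{2d}} ≅ U ⊕ 2E₈(−1) ⊕ U(2)`.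
*Proof.* […] We put `L_r = r^⊥_{L_{2d}}` and `S_r = (L_r)^⊥_{L_{K3}}`. We note that `L_r` and `S_r` have the same
determinant: in fact `det L_r = det S_r = 4d²/div(r)² = 1` if `div(r) = 2d`, `4` if `div(r) = d`. […] If
`div(r) = 2d` then `L_r` and `S_r` are isomorphic to the unique unimodular lattices of signatures `(2,18)` and `(1,1)`
respectively […]. If `div(r) = d` then […] `L_r` and `S_r` are `2`-elementary lattices. The finite discriminant forms
of `2`-elementary lattices were classified by Nikulin […] The genus of `M` (and the class of `M` if `M` is indefinite)
is determined by the signature of `M`, the number of generators `m` of `A_M` and the parity `δ_M` […]. In particular,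
for an indefinite lattice `S_r` of rank `2` and determinant `4` we have `S_r ≅ U(2)` if `δ_{S_r} = 0`, `⟨2⟩ ⊕ ⟨−2⟩` if
`δ_{S_r} = 1`. The class of the indefinite lattice `L_r` is uniquely defined by its discriminant form."

## What is here (all proved)

* §1 `S_r`: `orthogonal_orthogonal_orthogonal_span_pair` (`S_r^⊥ = L_r`),
  `two_mul_smul_eq_of_mem_orthogonal_orthogonal_span_pair` (`2d·w = (w,ℓ)ℓ − (w,r)r` on `S_r`),
  `finrank_orthogonal_orthogonal_span_pair` (`rk S_r = 2`), `signature_restrict_orthogonal_orthogonal_span_pair`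
  (`σ(S_r) = 0`, i.e. signature `(1, 1)`).
* §2 `L_r`: `finrank_orthogonal_span_pair_add_two` (`rk L_r = rk Λ − 2`), `signature_restrict_orthogonal_span_pair`
  (`σ(L_r) = σ(Λ)`), `length_restrict_orthogonal_span_pair_le_two` (`ℓ(L_r) = ℓ(S_r) ≤ 2`),
  `length_restrict_orthogonal_span_pair_ne_one` (Nikulin's condition 5 with `8 ∣ σ(Λ)`).
* §3 "`det L_r = 4d²/div(r)²`": `two_mul_dvd_of_isUnimodular_restrict_orthogonal_span_pair` and
  `isUnimodular_restrict_orthogonal_span_pair_of_two_mul_dvd` (**`L_r` unimodular ⟺ div(r) = 2d**, via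
  `Λ = L_r ⊕ S_r` and the explicit vector `q` with `2d·q = r − tℓ`), `isUnimodular_restrict_orthogonal_span_pair_iff`,
  `length_restrict_orthogonal_span_pair_eq_zero_iff`, `length_restrict_orthogonal_span_pair_eq_two_iff`,
  `natCard_discriminantGroup_restrict_orthogonal_span_pair` (`|A_{L_r}| = 1` resp. `4`).
* §4 models: `invariants_pi_neg_e8Form_prod_hyperbolicSum_prod_two_negTwo`
  (`E₈(−1)^m ⊕ U^n ⊕ ⟨2⟩ ⊕ ⟨−2⟩`: `(r, a, δ, σ) = (8m+2n+2, 2, 1, −8m)`),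
  `invariants_pi_neg_e8Form_prod_hyperbolicSum_prod_two_smul_hyperbolicSum` (`… ⊕ U(2)`: `(8m+2n+2, 2, 0, −8m)`).
* §5 **Prop. 4.6** for `Λ` of rank `22`, signature `−16`: `invariants_restrict_orthogonal_span_pair_of_neg_vector`
  (`L_r`: rank `20`, `σ = −16`, even, `2`-elementary, `ℓ ∈ {0, 2}`),
  **`restrict_orthogonal_span_pair_equivalent_of_two_mul_dvd`** (`div(r) = 2d ⟹ L_r ≅ 2U ⊕ 2E₈(−1)`),
  **`restrict_orthogonal_span_pair_equivalent_or_of_not_two_mul_dvd`** (`div(r) = d ⟹ L_r ≅ U ⊕ 2E₈(−1) ⊕ ⟨2⟩ ⊕ ⟨−2⟩`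
  or `≅ U ⊕ 2E₈(−1) ⊕ U(2)`), `restrict_orthogonal_span_pair_equivalent_of_deltaInvariant` (the two cases are
  `δ(L_r) = 1`, `δ(L_r) = 0`). The identification uses Nikulin's Thm. 3.6.2 (`IsTwoElementary.exists_isometry_of_invariants_eq`)
  and uniqueness in the genus for `rk ≥ ℓ + 3` (`equivalent_of_discriminantQuad_iso_of_isIndefinite_of_length_add_three_le`),
  also in the unimodular case (where GHS quote Milnor's theorem).

NOT here: the identification of the rank-`2` lattice `S_r` with `U`, `U(2)`, `⟨2⟩ ⊕ ⟨−2⟩` (the tree's uniqueness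
theorem needs `rk ≥ ℓ + 3`); only its invariants (§1, and `ℓ(S_r) = ℓ(L_r)`, `δ(S_r) = δ(L_r)` by
`invariants_restrict_orthogonal`) are recorded.

## References

* [GritsenkoHulekSankaran2007Kodaira] V. Gritsenko, K. Hulek, G. K. Sankaran, The Kodaira dimension of the moduli
  of K3 surfaces, Invent. Math. 169 (2007) 519–567 (arXiv:math/0607339): §4 (arXiv numbering) Prop. 4.6 and its
  proof.
* [Nikulin1980] V. V. Nikulin, Integral symmetric bilinear forms and some of their applications, Math. USSR Izv. 14
  (1980) 103–167: Cor. 1.13.3, Thm. 3.6.2.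
* [AlexeevNikulin2006] V. Alexeev, V. V. Nikulin, Del Pezzo and K3 surfaces, MSJ Memoirs 15 (2006), §9.2, §9.4.1
  (invariants `(r, a, δ)` of the standard `2`-elementary lattices).
* [Huybrechts2016K3] D. Huybrechts, Lectures on K3 Surfaces, CUP 2016, Ch. 14 §0.2 Prop. 0.2, Thm. 1.1, Thm. 1.5,
  Rem. 1.6.
* [Serre1973] J.-P. Serre, A Course in Arithmetic, GTM 7, Springer 1973, Ch. V §3.2 Lemma 1 (orthogonal summands of
  unimodular lattices).
-/

noncomputable section

open Module Function
open LinearMap (BilinForm)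
open LinearMap.BilinForm

namespace Literature.Topology.FourManifolds

universe u

variable {M : Type u} [AddCommGroup M] [Module.Free ℤ M] [Module.Finite ℤ M] (B : BilinForm ℤ M)

/-! ### §1 The lattice `S_r = (L_r)^⊥ = ({ℓ, r}^⊥)^⊥`: rank `2`, signature `0` -/

section Complement

omit [Module.Free ℤ M] [Module.Finite ℤ M] in
/-- `w ∈ {ℓ, r}^⊥ ⟺ (ℓ, w) = 0 ∧ (r, w) = 0`. [folklore] -/
private theorem mem_orthogonal_span_pair_iff' {ℓ r w : M} :
    w ∈ B.orthogonal (Submodule.span ℤ {ℓ, r}) ↔ B ℓ w = 0 ∧ B r w = 0 := by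
  rw [LinearMap.BilinForm.mem_orthogonal_iff]
  constructor
  · intro h
    exact ⟨h ℓ (Submodule.subset_span (by simp)), h r (Submodule.subset_span (by simp))⟩
  · rintro ⟨hℓ, hr⟩ n hn
    obtain ⟨a, c, rfl⟩ := Submodule.mem_span_pair.1 hn
    change B (a • ℓ + c • r) w = 0
    rw [map_add, map_smul, map_smul, LinearMap.add_apply, LinearMap.smul_apply, LinearMap.smul_apply, hℓ, hr,
      smul_zero, smul_zero, add_zero]

omit [Module.Free ℤ M] [Module.Finite ℤ M] in
/-- `N ∩ N^⊥ = 0` when `B|_N` is nondegenerate. [folklore] -/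
private theorem eq_zero_of_mem_of_mem_orthogonal' {N : Submodule ℤ M} (hnd : (B.restrict N).Nondegenerate) {w : M}
    (hw : w ∈ N) (hw' : w ∈ B.orthogonal N) : w = 0 := by
  have h := hnd.2 ⟨w, hw⟩ fun k ↦ (LinearMap.BilinForm.mem_orthogonal_iff.1 hw') k k.2
  exact congrArg Subtype.val h

omit [Module.Free ℤ M] [Module.Finite ℤ M] in
/-- **`(L_r^⊥)^⊥ = L_r`**: `N^⊥⊥⊥ = N^⊥` for the symmetric `B` and `N = ℤℓ + ℤr` (so `S_r^⊥ = L_r` in `Λ`).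
[cite: GritsenkoHulekSankaran2007Kodaira, §4 (arXiv numbering) proof of Prop. 4.6 ("`S_r = (L_r)^⊥_{L_{K3}}`")] -/
theorem orthogonal_orthogonal_orthogonal_span_pair (hs : B.IsSymm) {ℓ r : M} :
    B.orthogonal (B.orthogonal (B.orthogonal (Submodule.span ℤ {ℓ, r}))) = B.orthogonal (Submodule.span ℤ {ℓ, r}) :=
  le_antisymm (orthogonal_le (le_orthogonal_orthogonal hs.isRefl)) (le_orthogonal_orthogonal hs.isRefl)

omit [Module.Free ℤ M] [Module.Finite ℤ M] in
/-- **`2d·w ∈ ℤℓ + ℤr` for `w ∈ S_r`**, precisely `2d·w = (w,ℓ)ℓ − (w,r)r`: the difference lies in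
`L_r ∩ S_r = 0` (`L_r = {ℓ,r}^⊥` nondegenerate). [cite: GritsenkoHulekSankaran2007Kodaira, §4 (arXiv numbering) proof of Prop. 4.6 ("`N ⊕ N^⊥ ⊂ L ⊂ L^∨ ⊂ N^∨ ⊕ (N^⊥)^∨`")] -/
theorem two_mul_smul_eq_of_mem_orthogonal_orthogonal_span_pair (hs : B.IsSymm) {ℓ r : M} {d : ℤ}
    (hℓ : B ℓ ℓ = 2 * d) (hrℓ : B r ℓ = 0) (hr : B r r = -(2 * d))
    (hnd : (B.restrict (B.orthogonal (Submodule.span ℤ {ℓ, r}))).Nondegenerate) {w : M}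
    (hw : w ∈ B.orthogonal (B.orthogonal (Submodule.span ℤ {ℓ, r}))) :
    (2 * d) • w = B w ℓ • ℓ - B w r • r := by
  have hℓS : ℓ ∈ B.orthogonal (B.orthogonal (Submodule.span ℤ {ℓ, r})) :=
    le_orthogonal_orthogonal hs.isRefl (Submodule.subset_span (by simp))
  have hrS : r ∈ B.orthogonal (B.orthogonal (Submodule.span ℤ {ℓ, r})) :=
    le_orthogonal_orthogonal hs.isRefl (Submodule.subset_span (by simp))
  have hK : (2 * d) • w - B w ℓ • ℓ + B w r • r ∈ B.orthogonal (Submodule.span ℤ {ℓ, r}) := by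
    rw [mem_orthogonal_span_pair_iff']
    constructor
    · rw [map_add, map_sub, map_smul, map_smul, map_smul, smul_eq_mul, smul_eq_mul, smul_eq_mul, hℓ, hs.eq ℓ r,
        hrℓ, hs.eq ℓ w]
      ring
    · rw [map_add, map_sub, map_smul, map_smul, map_smul, smul_eq_mul, smul_eq_mul, smul_eq_mul, hrℓ, hr,
        hs.eq r w]
      ring
  have hS : (2 * d) • w - B w ℓ • ℓ + B w r • r ∈ B.orthogonal (B.orthogonal (Submodule.span ℤ {ℓ, r})) :=
    Submodule.add_mem _ (Submodule.sub_mem _ (Submodule.smul_mem _ _ hw) (Submodule.smul_mem _ _ hℓS))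
      (Submodule.smul_mem _ _ hrS)
  have h0 := eq_zero_of_mem_of_mem_orthogonal' B hnd hK hS
  rw [← sub_eq_zero, ← h0]
  abel

omit [Module.Free ℤ M] in
/-- **`rk S_r = 2`** (`S_r ⊇ ℤℓ ⊕ ℤr`, and `w ↦ ((ℓ,w), (r,w))` is injective on `S_r` since `L_r ∩ S_r = 0`).
[cite: GritsenkoHulekSankaran2007Kodaira, §4 (arXiv numbering) proof of Prop. 4.6 ("`S_r` … of signature `(1,1)`", "an indefinite lattice `S_r` of rank `2`")] -/
theorem finrank_orthogonal_orthogonal_span_pair (hs : B.IsSymm) {ℓ r : M} {d : ℤ} (hd0 : d ≠ 0)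
    (hℓ : B ℓ ℓ = 2 * d) (hrℓ : B r ℓ = 0) (hr : B r r = -(2 * d))
    (hnd : (B.restrict (B.orthogonal (Submodule.span ℤ {ℓ, r}))).Nondegenerate) :
    finrank ℤ (B.orthogonal (B.orthogonal (Submodule.span ℤ {ℓ, r}))) = 2 := by
  set S := B.orthogonal (B.orthogonal (Submodule.span ℤ {ℓ, r})) with hSdef
  have hℓS : ℓ ∈ S := le_orthogonal_orthogonal hs.isRefl (Submodule.subset_span (by simp))
  have hrS : r ∈ S := le_orthogonal_orthogonal hs.isRefl (Submodule.subset_span (by simp))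
  -- lower bound: `(a, c) ↦ aℓ + cr` is injective
  let g : ℤ × ℤ →ₗ[ℤ] S :=
    (LinearMap.fst ℤ ℤ ℤ).smulRight (⟨ℓ, hℓS⟩ : S) + (LinearMap.snd ℤ ℤ ℤ).smulRight (⟨r, hrS⟩ : S)
  have hg : Injective g := by
    refine (injective_iff_map_eq_zero g).2 fun p hp ↦ ?_
    have hp' : p.1 • ℓ + p.2 • r = 0 := by
      have := congrArg Subtype.val hp
      simpa [g] using this
    have h1 : B (p.1 • ℓ + p.2 • r) ℓ = 0 := by rw [hp', map_zero, LinearMap.zero_apply]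
    have h2 : B (p.1 • ℓ + p.2 • r) r = 0 := by rw [hp', map_zero, LinearMap.zero_apply]
    rw [map_add, map_smul, map_smul, LinearMap.add_apply, LinearMap.smul_apply, LinearMap.smul_apply, smul_eq_mul,
      smul_eq_mul, hℓ, hrℓ, mul_zero, add_zero] at h1
    rw [map_add, map_smul, map_smul, LinearMap.add_apply, LinearMap.smul_apply, LinearMap.smul_apply, smul_eq_mul,
      smul_eq_mul, hs.eq ℓ r, hrℓ, hr, mul_zero, zero_add] at h2
    have h1' : p.1 = 0 := by
      rcases mul_eq_zero.1 h1 with h | h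
      · exact h
      · omega
    have h2' : p.2 = 0 := by
      rcases mul_eq_zero.1 h2 with h | h
      · exact h
      · omega
    exact Prod.ext h1' h2'
  -- upper bound: `w ↦ ((ℓ, w), (r, w))` is injective
  let h : S →ₗ[ℤ] ℤ × ℤ := ((B ℓ).comp S.subtype).prod ((B r).comp S.subtype)
  have hh : Injective h := by
    refine (injective_iff_map_eq_zero h).2 fun w hw ↦ ?_
    have hw' : B ℓ w = 0 ∧ B r w = 0 := by
      have := Prod.ext_iff.1 hw
      simpa [h] using this
    exact Subtype.ext (eq_zero_of_mem_of_mem_orthogonal' B hnd ((mem_orthogonal_span_pair_iff' B).2 hw') w.2)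
  have hle := LinearMap.finrank_le_finrank_of_injective hg
  have hge := LinearMap.finrank_le_finrank_of_injective hh
  rw [Module.finrank_prod, Module.finrank_self] at hle hge
  omega

omit [Module.Free ℤ M] in
/-- **`σ(S_r) = 0`**, i.e. `S_r` has signature `(1, 1)`: it has rank `2` and contains `ℓ` (`ℓ² = 2d > 0`) and `r`
(`r² = −2d < 0`). [cite: GritsenkoHulekSankaran2007Kodaira, §4 (arXiv numbering) proof of Prop. 4.6 ("`S_r` … of signature `(1,1)`")] -/
theorem signature_restrict_orthogonal_orthogonal_span_pair (hs : B.IsSymm) {ℓ r : M} {d : ℤ} (hd : 0 < d)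
    (hℓ : B ℓ ℓ = 2 * d) (hrℓ : B r ℓ = 0) (hr : B r r = -(2 * d))
    (hnd : (B.restrict (B.orthogonal (Submodule.span ℤ {ℓ, r}))).Nondegenerate) :
    (B.restrict (B.orthogonal (B.orthogonal (Submodule.span ℤ {ℓ, r})))).signature = 0 := by
  set S := B.orthogonal (B.orthogonal (Submodule.span ℤ {ℓ, r})) with hSdef
  have hℓS : ℓ ∈ S := le_orthogonal_orthogonal hs.isRefl (Submodule.subset_span (by simp))
  have hrS : r ∈ S := le_orthogonal_orthogonal hs.isRefl (Submodule.subset_span (by simp))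
  have h1 : 1 ≤ sigPos (B.restrict S).toQuadraticMap :=
    one_le_sigPos_of_pos (B.restrict S) (v := ⟨ℓ, hℓS⟩) (by change 0 < B ℓ ℓ; omega)
  have h2 : 1 ≤ sigNeg (B.restrict S).toQuadraticMap := by
    rw [← sigPos_neg, show -(B.restrict S).toQuadraticMap = (-(B.restrict S)).toQuadraticMap from rfl]
    exact one_le_sigPos_of_pos (-(B.restrict S)) (v := ⟨r, hrS⟩) (by change 0 < -(B r r); omega)
  have h3 := sigPos_add_sigNeg_le_finrank (B.restrict S).toQuadraticMap
  have h4 := finrank_orthogonal_orthogonal_span_pair B hs hd.ne' hℓ hrℓ hr hnd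
  rw [← hSdef] at h4
  rw [signature]
  omega

end Complement

/-! ### §2 The invariants of `L_r = {ℓ, r}^⊥`: rank `rk Λ − 2`, signature `σ(Λ)`, `ℓ(L_r) ≤ 2`, `ℓ(L_r) ≠ 1` -/

section Invariants

/-- **`rk L_r = rk Λ − 2`** (`rk L_r + rk S_r = rk Λ`, `rk S_r = 2`). [cite: GritsenkoHulekSankaran2007Kodaira, §4 (arXiv numbering) Prop. 4.6 (`L_r` of rank `20` in `L_{K3}`)] -/
theorem finrank_orthogonal_span_pair_add_two (hs : B.IsSymm) {ℓ r : M} {d : ℤ} (hd0 : d ≠ 0)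
    (hℓ : B ℓ ℓ = 2 * d) (hrℓ : B r ℓ = 0) (hr : B r r = -(2 * d))
    (hnd : (B.restrict (B.orthogonal (Submodule.span ℤ {ℓ, r}))).Nondegenerate) :
    finrank ℤ (B.orthogonal (Submodule.span ℤ {ℓ, r})) + 2 = finrank ℤ M := by
  rw [← finrank_orthogonal_orthogonal_span_pair B hs hd0 hℓ hrℓ hr hnd]
  exact finrank_add_finrank_orthogonal_of_nondegenerate B _ hs hnd

/-- **`σ(L_r) = σ(Λ)`** (`σ(L_r) + σ(S_r) = σ(Λ)` for the primitive nondegenerate `L_r` of the unimodular `Λ`, and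
`σ(S_r) = 0`); in `L_{K3}`: `L_r` has signature `(2, 18)`. [cite: GritsenkoHulekSankaran2007Kodaira, §4 (arXiv numbering) proof of Prop. 4.6 ("unimodular lattices of signatures `(2,18)` and `(1,1)`")] [cite: Huybrechts2016K3, Ch. 14 §0.2 Prop. 0.2] -/
theorem signature_restrict_orthogonal_span_pair (hs : B.IsSymm) (hu : B.IsUnimodular) {ℓ r : M} {d : ℤ}
    (hd : 0 < d) (hℓ : B ℓ ℓ = 2 * d) (hrℓ : B r ℓ = 0) (hr : B r r = -(2 * d))
    (hnd : (B.restrict (B.orthogonal (Submodule.span ℤ {ℓ, r}))).Nondegenerate) :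
    (B.restrict (B.orthogonal (Submodule.span ℤ {ℓ, r}))).signature = B.signature := by
  haveI : B.IsPerfPair := hu
  have h1 := signature_restrict_add_signature_restrict_orthogonal B (B.orthogonal (Submodule.span ℤ {ℓ, r})) hs
    (fun k x hk hx ↦ mem_orthogonal_of_smul_mem B _ hk hx) hnd
  rw [signature_restrict_orthogonal_orthogonal_span_pair B hs hd hℓ hrℓ hr hnd, add_zero] at h1
  exact h1

/-- **`ℓ(L_r) = ℓ(S_r) ≤ rk S_r = 2`** (`A_{L_r} ≅ A_{S_r}` as `Λ` is unimodular — "`L_r` and `S_r` have the same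
determinant"). [cite: GritsenkoHulekSankaran2007Kodaira, §4 (arXiv numbering) proof of Prop. 4.6 ("`det L_r = det S_r`")] [cite: Huybrechts2016K3, Ch. 14 §0.2 Prop. 0.2, §3.3 ("`ℓ(A_Λ) = ℓ(A_{Λ^⊥}) ≤ rk Λ^⊥`")] -/
theorem length_restrict_orthogonal_span_pair_le_two (hs : B.IsSymm) (he : B.IsEven) (hu : B.IsUnimodular)
    {ℓ r : M} {d : ℤ} (hd0 : d ≠ 0) (hℓ : B ℓ ℓ = 2 * d) (hrℓ : B r ℓ = 0) (hr : B r r = -(2 * d))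
    (hnd : (B.restrict (B.orthogonal (Submodule.span ℤ {ℓ, r}))).Nondegenerate) :
    (B.restrict (B.orthogonal (Submodule.span ℤ {ℓ, r}))).length ≤ 2 := by
  haveI : B.IsPerfPair := hu
  obtain ⟨-, hlen, -⟩ := invariants_restrict_orthogonal B (B.orthogonal (Submodule.span ℤ {ℓ, r})) hs he
    (fun k x hk hx ↦ mem_orthogonal_of_smul_mem B _ hk hx) hnd
  rw [hlen, ← finrank_orthogonal_orthogonal_span_pair B hs hd0 hℓ hrℓ hr hnd]
  exact length_le_finrank _

/-- **`ℓ(L_r) ≠ 1`**: `L_r` is even and `2`-elementary with `σ(L_r) = σ(Λ) ≡ 0 (mod 8)`, while `a = 1` forces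
`σ ≡ ±1 (mod 8)` (Nikulin's condition 5) — equivalently "`det L_r = 4d²/div(r)²`" is a square.
[cite: GritsenkoHulekSankaran2007Kodaira, §4 (arXiv numbering) proof of Prop. 4.6 ("`det L_r = … = 1` if `div(r) = 2d`, `4` if `div(r) = d`")] [cite: AlexeevNikulin2006, §9.2 Thm. 9.9 (condition 5)] [cite: Nikulin1980, Thm. 3.6.2] -/
theorem length_restrict_orthogonal_span_pair_ne_one (hs : B.IsSymm) (he : B.IsEven) (hu : B.IsUnimodular)
    {ℓ r : M} {d : ℤ} (hd : 0 < d) (hℓ : B ℓ ℓ = 2 * d) (hrℓ : B r ℓ = 0) (hr : B r r = -(2 * d))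
    (hnd : (B.restrict (B.orthogonal (Submodule.span ℤ {ℓ, r}))).Nondegenerate)
    (h2 : (B.restrict (B.orthogonal (Submodule.span ℤ {ℓ, r}))).IsTwoElementary) :
    (B.restrict (B.orthogonal (Submodule.span ℤ {ℓ, r}))).length ≠ 1 := by
  intro h1
  obtain ⟨-, -, -, -, h5, -⟩ := h2.nikulin_necessary_conditions _ hnd (hs.restrict _) (isEven_restrict he _)
  have h8 : (8 : ℤ) ∣ B.signature := LinearMap.BilinForm.eight_dvd_sigPos_sub_sigNeg B hs hu he
  rw [signature_restrict_orthogonal_span_pair B hs hu hd hℓ hrℓ hr hnd] at h5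
  rcases h5 h1 with h | h <;> omega

end Invariants

/-! ### §3 `L_r` is unimodular iff `div(r) = 2d` ("`det L_r = 4d²/div(r)²`") -/

section Unimodular

omit [Module.Free ℤ M] [Module.Finite ℤ M] in
/-- **`L_r` unimodular ⟹ `2d ∣ (r, w)` for all `w ∈ ℓ^⊥`** (`div(r) = 2d`): `Λ = L_r ⊕ S_r`, so `w = k + u` with
`k ∈ L_r`, `u ∈ S_r ∩ ℓ^⊥ = ℤr` (`2d·u = (u,ℓ)ℓ − (u,r)r = −(u,r)r` and `r` is primitive), whence
`(r, w) = (r, u) ∈ 2dℤ`. [cite: GritsenkoHulekSankaran2007Kodaira, §4 (arXiv numbering) proof of Prop. 4.6 ("`det L_r = 4d²/div(r)² = 1` if `div(r) = 2d`")] -/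
theorem two_mul_dvd_of_isUnimodular_restrict_orthogonal_span_pair (hs : B.IsSymm) {ℓ r : M} {d : ℤ} (hd : 0 < d)
    (hℓ : B ℓ ℓ = 2 * d) (hrℓ : B r ℓ = 0) (hr : B r r = -(2 * d))
    (hrsat : ∀ (k : ℤ) (w : M), k ≠ 0 → k • w ∈ ℤ ∙ r → w ∈ ℤ ∙ r)
    (hnd : (B.restrict (B.orthogonal (Submodule.span ℤ {ℓ, r}))).Nondegenerate)
    (hKu : (B.restrict (B.orthogonal (Submodule.span ℤ {ℓ, r}))).IsUnimodular) (w : M) (hw : B w ℓ = 0) :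
    2 * d ∣ B r w := by
  set K := B.orthogonal (Submodule.span ℤ {ℓ, r}) with hKdef
  have hc : IsCompl K (B.orthogonal K) := isCompl_orthogonal_of_isUnimodular_restrict K hKu
  have hw' : w ∈ K ⊔ B.orthogonal K := by rw [hc.sup_eq_top]; exact Submodule.mem_top
  obtain ⟨k, hk, u, hu, rfl⟩ := Submodule.mem_sup.1 hw'
  have hk' := (mem_orthogonal_span_pair_iff' B).1 hk
  have huℓ : B u ℓ = 0 := by
    rw [map_add, LinearMap.add_apply, hs.eq k ℓ, hk'.1, zero_add] at hw
    exact hw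
  -- `2d·u = −(u,r)r`, so `u ∈ ℤr`
  have h2du := two_mul_smul_eq_of_mem_orthogonal_orthogonal_span_pair B hs hℓ hrℓ hr hnd hu
  rw [huℓ, zero_smul, zero_sub] at h2du
  have hmem : (2 * d) • u ∈ ℤ ∙ r := by
    rw [h2du]
    exact Submodule.neg_mem _ (Submodule.smul_mem _ _ (Submodule.mem_span_singleton_self r))
  have hu' : u ∈ ℤ ∙ r := hrsat (2 * d) u (by omega) hmem
  obtain ⟨c, rfl⟩ := Submodule.mem_span_singleton.1 hu'
  rw [map_add, map_smul, smul_eq_mul, hk'.2, zero_add, hr]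
  exact ⟨-c, by ring⟩

/-- **`2d ∣ (r, ℓ^⊥)` ⟹ `L_r` is unimodular** (`div(r) = 2d` ⟹ `det L_r = 1`): with `(x₀, ℓ) = 1`, `t = (r, x₀)`
one has `(r, x) ≡ t(ℓ, x) (mod 2d)` on `Λ`, so `2d·q = r − tℓ` for some `q ∈ S_r` with `(q,ℓ) = −t`, `(q,r) = −1`,
`2d·q² = t² − 1`; then every `x ∈ Λ` is `k + s` with `s = −((x,ℓ)q² + mt)ℓ − (t(x,ℓ) + 2dm)q ∈ S_r`
(`(r,x) − t(ℓ,x) = 2dm`) and `k ∈ L_r`, i.e. `Λ = L_r ⊕ S_r`, and an orthogonal direct summand of a unimodular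
lattice is unimodular. [cite: GritsenkoHulekSankaran2007Kodaira, §4 (arXiv numbering) proof of Prop. 4.6 ("`det L_r = 4d²/div(r)² = 1` if `div(r) = 2d`"), proof of Cor. 4.4 ("`r = dm₀ + xh`")] [cite: Serre1973, Ch. V §3.2 Lemma 1] -/
theorem isUnimodular_restrict_orthogonal_span_pair_of_two_mul_dvd (hs : B.IsSymm) (he : B.IsEven)
    (hu : B.IsUnimodular) {ℓ r : M} {d : ℤ} (hd : 0 < d) (hℓ : B ℓ ℓ = 2 * d)
    (hℓsat : ∀ (k : ℤ) (w : M), k ≠ 0 → k • w ∈ ℤ ∙ ℓ → w ∈ ℤ ∙ ℓ) (hrℓ : B r ℓ = 0) (hr : B r r = -(2 * d))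
    (hrsat : ∀ (k : ℤ) (w : M), k ≠ 0 → k • w ∈ ℤ ∙ r → w ∈ ℤ ∙ r) (h2d : ∀ w, B w ℓ = 0 → 2 * d ∣ B r w) :
    (B.restrict (B.orthogonal (Submodule.span ℤ {ℓ, r}))).IsUnimodular := by
  haveI : B.IsPerfPair := hu
  have hd0 : (2 : ℤ) * d ≠ 0 := by omega
  have hdvd : ∀ w, B w ℓ = 0 → d ∣ B r w := fun w hw ↦ (dvd_mul_left d 2).trans (h2d w hw)
  have hnd := nondegenerate_restrict_orthogonal_span_pair_of_neg_vector B hs he hu hd hℓ hℓsat hrℓ hr hrsat hdvd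
  set K := B.orthogonal (Submodule.span ℤ {ℓ, r}) with hKdef
  have hℓS : ℓ ∈ B.orthogonal K := le_orthogonal_orthogonal hs.isRefl (Submodule.subset_span (by simp))
  have hℓ0 : ℓ ≠ 0 := by
    rintro rfl
    simp only [map_zero] at hℓ
    omega
  -- `x₀`, `t`, and `q` with `2d·q = r − tℓ`
  obtain ⟨x₀, hx₀⟩ := exists_apply_eq_one_of_isUnimodular_of_primitive B hu hℓ0 hℓsat
  set t := B r x₀ with ht
  have hq' : ∀ z, 2 * d ∣ B (r - t • ℓ) z := fun z ↦ by
    rw [map_sub, map_smul, LinearMap.sub_apply, LinearMap.smul_apply, smul_eq_mul, hs.eq ℓ z]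
    exact dvd_apply_sub_mul_apply B hx₀ h2d z
  obtain ⟨f, hf⟩ := exists_dual_smul_eq_of_forall_dvd B hq'
  obtain ⟨q, hq⟩ := (LinearMap.IsPerfPair.bijective_left B).2 f
  have hdq : (2 * d) • q = r - t • ℓ := injective_of_nondegenerate B hu.nondegenerate (by rw [map_smul, hq, hf])
  have hBq : ∀ z, 2 * d * B q z = B r z - t * B ℓ z := fun z ↦ by
    have := LinearMap.congr_fun (congrArg B hdq) z
    rw [map_smul, LinearMap.smul_apply, smul_eq_mul, map_sub, map_smul, LinearMap.sub_apply, LinearMap.smul_apply,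
      smul_eq_mul] at this
    exact this
  have hqℓ : B q ℓ = -t := by
    have h1 := hBq ℓ
    rw [hrℓ, hℓ] at h1
    have h2 : 2 * d * (B q ℓ + t) = 0 := by linear_combination h1
    have h3 := (mul_eq_zero.1 h2).resolve_left hd0
    omega
  have hqr : B q r = -1 := by
    have h1 := hBq r
    rw [hr, hs.eq ℓ r, hrℓ] at h1
    have h2 : 2 * d * (B q r + 1) = 0 := by linear_combination h1
    have h3 := (mul_eq_zero.1 h2).resolve_left hd0
    omega
  -- `2d·(q,q) = t² − 1`
  have hqq : 2 * d * B q q = t * t - 1 := by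
    have h1 := hBq q
    rw [hs.eq r q, hqr, hs.eq ℓ q, hqℓ] at h1
    linear_combination h1
  -- `q ∈ S_r`
  have hqS : q ∈ B.orthogonal K := by
    rw [LinearMap.BilinForm.mem_orthogonal_iff]
    intro k hk
    have hk' := (mem_orthogonal_span_pair_iff' B).1 hk
    have h1 := hBq k
    rw [hk'.2, hk'.1, mul_zero, sub_zero] at h1
    change B k q = 0
    rw [hs.eq k q]
    exact (mul_eq_zero.1 h1).resolve_left hd0
  -- `Λ = L_r ⊕ S_r`
  have hc : IsCompl K (B.orthogonal K) := by
    refine ⟨Submodule.disjoint_def.2 fun x hx hx' ↦ eq_zero_of_mem_of_mem_orthogonal' B hnd hx hx', ?_⟩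
    rw [Submodule.codisjoint_iff_exists_add_eq]
    intro x
    obtain ⟨m, hm⟩ := dvd_apply_sub_mul_apply B hx₀ h2d x
    rw [← ht] at hm
    refine ⟨x - ((-(B x ℓ * B q q) - m * t) • ℓ + (-(t * B x ℓ) - 2 * d * m) • q),
      (-(B x ℓ * B q q) - m * t) • ℓ + (-(t * B x ℓ) - 2 * d * m) • q, ?_,
      Submodule.add_mem _ (Submodule.smul_mem _ _ hℓS) (Submodule.smul_mem _ _ hqS), sub_add_cancel _ _⟩
    rw [mem_orthogonal_span_pair_iff']
    constructor
    · rw [hs.eq ℓ, map_sub, map_add, map_smul, map_smul, LinearMap.sub_apply, LinearMap.add_apply,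
        LinearMap.smul_apply, LinearMap.smul_apply, smul_eq_mul, smul_eq_mul, hℓ, hqℓ]
      linear_combination (B x ℓ) * hqq
    · rw [hs.eq r, map_sub, map_add, map_smul, map_smul, LinearMap.sub_apply, LinearMap.add_apply,
        LinearMap.smul_apply, LinearMap.smul_apply, smul_eq_mul, smul_eq_mul, hs.eq ℓ r, hrℓ, hqr, hs.eq x r]
      linear_combination hm
  -- an orthogonal direct summand of a unimodular lattice is unimodular
  obtain ⟨e, -⟩ := exists_isometryEquiv_prod_restrict_orthogonal K hs.isRefl hc
  haveI : ((B.restrict K).prod (B.restrict (B.orthogonal K))).IsPerfPair := isPerfPair_of_isometryEquiv e.symm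
  exact isPerfPair_of_prod_left (B₁ := B.restrict K) (B₂ := B.restrict (B.orthogonal K))

/-- **`L_r` is unimodular ⟺ `div(r) = 2d`**, i.e. iff `2d ∣ (r, w)` for all `w ∈ ℓ^⊥` ("`det L_r = 4d²/div(r)²`").
[cite: GritsenkoHulekSankaran2007Kodaira, §4 (arXiv numbering) proof of Prop. 4.6 ("`det L_r = det S_r = 4d²/div(r)²`")] -/
theorem isUnimodular_restrict_orthogonal_span_pair_iff (hs : B.IsSymm) (he : B.IsEven) (hu : B.IsUnimodular)
    {ℓ r : M} {d : ℤ} (hd : 0 < d) (hℓ : B ℓ ℓ = 2 * d)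
    (hℓsat : ∀ (k : ℤ) (w : M), k ≠ 0 → k • w ∈ ℤ ∙ ℓ → w ∈ ℤ ∙ ℓ) (hrℓ : B r ℓ = 0) (hr : B r r = -(2 * d))
    (hrsat : ∀ (k : ℤ) (w : M), k ≠ 0 → k • w ∈ ℤ ∙ r → w ∈ ℤ ∙ r) (hdvd : ∀ w, B w ℓ = 0 → d ∣ B r w) :
    (B.restrict (B.orthogonal (Submodule.span ℤ {ℓ, r}))).IsUnimodular ↔ ∀ w, B w ℓ = 0 → 2 * d ∣ B r w :=
  ⟨fun h ↦ two_mul_dvd_of_isUnimodular_restrict_orthogonal_span_pair B hs hd hℓ hrℓ hr hrsat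
      (nondegenerate_restrict_orthogonal_span_pair_of_neg_vector B hs he hu hd hℓ hℓsat hrℓ hr hrsat hdvd) h,
    isUnimodular_restrict_orthogonal_span_pair_of_two_mul_dvd B hs he hu hd hℓ hℓsat hrℓ hr hrsat⟩

/-- **`ℓ(L_r) = 0 ⟺ div(r) = 2d`** and then `|A_{L_r}| = det L_r = 1`. [cite: GritsenkoHulekSankaran2007Kodaira, §4 (arXiv numbering) proof of Prop. 4.6] [cite: Huybrechts2016K3, Ch. 14 §0.1 ("unimodular … equivalently, if `A_Λ` is trivial")] -/
theorem length_restrict_orthogonal_span_pair_eq_zero_iff (hs : B.IsSymm) (he : B.IsEven) (hu : B.IsUnimodular)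
    {ℓ r : M} {d : ℤ} (hd : 0 < d) (hℓ : B ℓ ℓ = 2 * d)
    (hℓsat : ∀ (k : ℤ) (w : M), k ≠ 0 → k • w ∈ ℤ ∙ ℓ → w ∈ ℤ ∙ ℓ) (hrℓ : B r ℓ = 0) (hr : B r r = -(2 * d))
    (hrsat : ∀ (k : ℤ) (w : M), k ≠ 0 → k • w ∈ ℤ ∙ r → w ∈ ℤ ∙ r) (hdvd : ∀ w, B w ℓ = 0 → d ∣ B r w) :
    (B.restrict (B.orthogonal (Submodule.span ℤ {ℓ, r}))).length = 0 ↔ ∀ w, B w ℓ = 0 → 2 * d ∣ B r w := by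
  rw [length_eq_zero_iff_isUnimodular _
    (nondegenerate_restrict_orthogonal_span_pair_of_neg_vector B hs he hu hd hℓ hℓsat hrℓ hr hrsat hdvd)]
  exact isUnimodular_restrict_orthogonal_span_pair_iff B hs he hu hd hℓ hℓsat hrℓ hr hrsat hdvd

/-- **`ℓ(L_r) ∈ {0, 2}`, with `ℓ(L_r) = 2 ⟺ div(r) = d`** (i.e. `2d ∤ (r, w)` for some `w ∈ ℓ^⊥`): then
`|A_{L_r}| = det L_r = 4`. [cite: GritsenkoHulekSankaran2007Kodaira, §4 (arXiv numbering) proof of Prop. 4.6 ("`det L_r = … = 4` if `div(r) = d`")] -/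
theorem length_restrict_orthogonal_span_pair_eq_two_iff (hs : B.IsSymm) (he : B.IsEven) (hu : B.IsUnimodular)
    {ℓ r : M} {d : ℤ} (hd : 0 < d) (hℓ : B ℓ ℓ = 2 * d)
    (hℓsat : ∀ (k : ℤ) (w : M), k ≠ 0 → k • w ∈ ℤ ∙ ℓ → w ∈ ℤ ∙ ℓ) (hrℓ : B r ℓ = 0) (hr : B r r = -(2 * d))
    (hrsat : ∀ (k : ℤ) (w : M), k ≠ 0 → k • w ∈ ℤ ∙ r → w ∈ ℤ ∙ r) (hdvd : ∀ w, B w ℓ = 0 → d ∣ B r w) :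
    (B.restrict (B.orthogonal (Submodule.span ℤ {ℓ, r}))).length = 2 ↔ ¬ ∀ w, B w ℓ = 0 → 2 * d ∣ B r w := by
  rw [← length_restrict_orthogonal_span_pair_eq_zero_iff B hs he hu hd hℓ hℓsat hrℓ hr hrsat hdvd]
  have hnd := nondegenerate_restrict_orthogonal_span_pair_of_neg_vector B hs he hu hd hℓ hℓsat hrℓ hr hrsat hdvd
  have hle := length_restrict_orthogonal_span_pair_le_two B hs he hu hd.ne' hℓ hrℓ hr hnd
  have hne := length_restrict_orthogonal_span_pair_ne_one B hs he hu hd hℓ hrℓ hr hnd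
    (isTwoElementary_restrict_orthogonal_span_pair_of_neg_vector B hs he hu hd hℓ hℓsat hrℓ hr hrsat hdvd)
  omega

/-- **"`det L_r = 4d²/div(r)²`"**: `|A_{L_r}| = 1` if `div(r) = 2d` and `|A_{L_r}| = 4` if `div(r) = d`.
[cite: GritsenkoHulekSankaran2007Kodaira, §4 (arXiv numbering) proof of Prop. 4.6 ("`det L_r = det S_r = 4d²/div(r)²`")] -/
theorem natCard_discriminantGroup_restrict_orthogonal_span_pair (hs : B.IsSymm) (he : B.IsEven)
    (hu : B.IsUnimodular) {ℓ r : M} {d : ℤ} (hd : 0 < d) (hℓ : B ℓ ℓ = 2 * d)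
    (hℓsat : ∀ (k : ℤ) (w : M), k ≠ 0 → k • w ∈ ℤ ∙ ℓ → w ∈ ℤ ∙ ℓ) (hrℓ : B r ℓ = 0) (hr : B r r = -(2 * d))
    (hrsat : ∀ (k : ℤ) (w : M), k ≠ 0 → k • w ∈ ℤ ∙ r → w ∈ ℤ ∙ r) (hdvd : ∀ w, B w ℓ = 0 → d ∣ B r w) :
    ((∀ w, B w ℓ = 0 → 2 * d ∣ B r w) →
      Nat.card (B.restrict (B.orthogonal (Submodule.span ℤ {ℓ, r}))).discriminantGroup = 1) ∧
    ((¬ ∀ w, B w ℓ = 0 → 2 * d ∣ B r w) →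
      Nat.card (B.restrict (B.orthogonal (Submodule.span ℤ {ℓ, r}))).discriminantGroup = 4) := by
  have hnd := nondegenerate_restrict_orthogonal_span_pair_of_neg_vector B hs he hu hd hℓ hℓsat hrℓ hr hrsat hdvd
  have h2 := isTwoElementary_restrict_orthogonal_span_pair_of_neg_vector B hs he hu hd hℓ hℓsat hrℓ hr hrsat hdvd
  rw [h2.natCard_eq_two_pow_length _ hnd]
  constructor
  · intro h
    rw [(length_restrict_orthogonal_span_pair_eq_zero_iff B hs he hu hd hℓ hℓsat hrℓ hr hrsat hdvd).2 h, pow_zero]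
  · intro h
    rw [(length_restrict_orthogonal_span_pair_eq_two_iff B hs he hu hd hℓ hℓsat hrℓ hr hrsat hdvd).2 h]
    norm_num

end Unimodular

/-! ### §4 The models `2U ⊕ 2E₈(−1)`, `U ⊕ 2E₈(−1) ⊕ ⟨2⟩ ⊕ ⟨−2⟩`, `U ⊕ 2E₈(−1) ⊕ U(2)` and their invariants -/

section Models

variable (m n : ℕ)

/-- **`(r, a, δ, σ)(E₈(−1)^{⊕m} ⊕ U^{⊕n} ⊕ ⟨2⟩ ⊕ ⟨−2⟩) = (8m + 2n + 2, 2, 1, −8m)`** (the unimodular part contributes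
`a = 0`, `δ = 0`; `⟨2⟩ ⊕ ⟨−2⟩` has `(r, a, δ) = (2, 2, 1)`, `σ = 0`); `m = 2`, `n = 1`: GHS's
`U ⊕ 2E₈(−1) ⊕ ⟨2⟩ ⊕ ⟨−2⟩`, the case `δ_{S_r} = 1`. [cite: GritsenkoHulekSankaran2007Kodaira, §4 (arXiv numbering) Prop. 4.6 and its proof ("`⟨2⟩ ⊕ ⟨−2⟩` if `δ_{S_r} = 1`")] [cite: AlexeevNikulin2006, §9.2 ("`⟨±2⟩ ⊕ ⟨±2⟩`"), §9.4.1] -/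
theorem invariants_pi_neg_e8Form_prod_hyperbolicSum_prod_two_negTwo :
    (((pi fun _ : Fin m ↦ -e8Form).prod (hyperbolicSum n)).prod
      (BilinForm.prod ((2 : ℤ) • ((1 : ℤ) • LinearMap.mul ℤ ℤ)) ((2 : ℤ) • ((-1 : ℤ) • LinearMap.mul ℤ ℤ)))).IsSymm ∧
    (((pi fun _ : Fin m ↦ -e8Form).prod (hyperbolicSum n)).prod
      (BilinForm.prod ((2 : ℤ) • ((1 : ℤ) • LinearMap.mul ℤ ℤ)) ((2 : ℤ) • ((-1 : ℤ) • LinearMap.mul ℤ ℤ)))).IsEven ∧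
    (((pi fun _ : Fin m ↦ -e8Form).prod (hyperbolicSum n)).prod
      (BilinForm.prod ((2 : ℤ) • ((1 : ℤ) • LinearMap.mul ℤ ℤ)) ((2 : ℤ) • ((-1 : ℤ) • LinearMap.mul ℤ ℤ)))).Nondegenerate ∧
    (((pi fun _ : Fin m ↦ -e8Form).prod (hyperbolicSum n)).prod
      (BilinForm.prod ((2 : ℤ) • ((1 : ℤ) • LinearMap.mul ℤ ℤ)) ((2 : ℤ) • ((-1 : ℤ) • LinearMap.mul ℤ ℤ)))).IsTwoElementary ∧
    (((pi fun _ : Fin m ↦ -e8Form).prod (hyperbolicSum n)).prod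
      (BilinForm.prod ((2 : ℤ) • ((1 : ℤ) • LinearMap.mul ℤ ℤ)) ((2 : ℤ) • ((-1 : ℤ) • LinearMap.mul ℤ ℤ)))).length = 2 ∧
    (((pi fun _ : Fin m ↦ -e8Form).prod (hyperbolicSum n)).prod
      (BilinForm.prod ((2 : ℤ) • ((1 : ℤ) • LinearMap.mul ℤ ℤ)) ((2 : ℤ) • ((-1 : ℤ) • LinearMap.mul ℤ ℤ)))).signature = -(8 * m) ∧
    finrank ℤ (((Fin m → Fin 8 → ℤ) × ((Fin n → ℤ) × (Fin n → ℤ))) × (ℤ × ℤ)) = 8 * m + 2 * n + 2 ∧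
    ∀ (h₁ : (((pi fun _ : Fin m ↦ -e8Form).prod (hyperbolicSum n)).prod
        (BilinForm.prod ((2 : ℤ) • ((1 : ℤ) • LinearMap.mul ℤ ℤ)) ((2 : ℤ) • ((-1 : ℤ) • LinearMap.mul ℤ ℤ)))).Nondegenerate)
      (h₂ : (((pi fun _ : Fin m ↦ -e8Form).prod (hyperbolicSum n)).prod
        (BilinForm.prod ((2 : ℤ) • ((1 : ℤ) • LinearMap.mul ℤ ℤ)) ((2 : ℤ) • ((-1 : ℤ) • LinearMap.mul ℤ ℤ)))).IsSymm)
      (h₃ : (((pi fun _ : Fin m ↦ -e8Form).prod (hyperbolicSum n)).prod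
        (BilinForm.prod ((2 : ℤ) • ((1 : ℤ) • LinearMap.mul ℤ ℤ)) ((2 : ℤ) • ((-1 : ℤ) • LinearMap.mul ℤ ℤ)))).IsEven),
      (((pi fun _ : Fin m ↦ -e8Form).prod (hyperbolicSum n)).prod
        (BilinForm.prod ((2 : ℤ) • ((1 : ℤ) • LinearMap.mul ℤ ℤ))
          ((2 : ℤ) • ((-1 : ℤ) • LinearMap.mul ℤ ℤ)))).deltaInvariant h₁ h₂ h₃ = 1 := by
  obtain ⟨hs, he, hu, hσ⟩ := pi_neg_e8Form_prod_hyperbolicSum_invariants m n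
  -- the rank-2 part `⟨2⟩ ⊕ ⟨−2⟩`
  have hnd' : ∀ {ε : ℤ}, ε * ε = 1 → BilinForm.Nondegenerate ((2 : ℤ) • (ε • LinearMap.mul ℤ ℤ)) := fun hε ↦
    (nondegenerate_zsmul_iff _ two_ne_zero).2 (IsUnimodular.nondegenerate (isPerfPair_smul_mul hε))
  have hsy : ∀ ε : ℤ, BilinForm.IsSymm ((2 : ℤ) • (ε • LinearMap.mul ℤ ℤ)) := fun ε ↦
    isSymm_smul_of_isSymm _ 2 (isSymm_smul_mul ε)
  have hev : ∀ ε : ℤ, BilinForm.IsEven ((2 : ℤ) • (ε • LinearMap.mul ℤ ℤ)) := fun ε z ↦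
    ⟨(ε • LinearMap.mul ℤ ℤ) z z, by rw [smul_apply_apply]; ring⟩
  have h1 : (1 : ℤ) * 1 = 1 := by norm_num
  have h1' : (-1 : ℤ) * -1 = 1 := by norm_num
  have hAn : (BilinForm.prod ((2 : ℤ) • ((1 : ℤ) • LinearMap.mul ℤ ℤ))
      ((2 : ℤ) • ((-1 : ℤ) • LinearMap.mul ℤ ℤ))).Nondegenerate := (hnd' h1).prod (hnd' h1')
  have hAs : (BilinForm.prod ((2 : ℤ) • ((1 : ℤ) • LinearMap.mul ℤ ℤ))
      ((2 : ℤ) • ((-1 : ℤ) • LinearMap.mul ℤ ℤ))).IsSymm := (hsy 1).prod (hsy (-1))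
  have hAe : (BilinForm.prod ((2 : ℤ) • ((1 : ℤ) • LinearMap.mul ℤ ℤ))
      ((2 : ℤ) • ((-1 : ℤ) • LinearMap.mul ℤ ℤ))).IsEven := isEven_prod_iff.2 ⟨hev 1, hev (-1)⟩
  obtain ⟨hArk, hA2, hAℓ, hAδ, hAσ⟩ := invariants_two_smul_smul_mul_prod h1 h1' hAn hAs hAe
  refine ⟨hs.prod hAs, isEven_prod_iff.2 ⟨he, hAe⟩, hu.nondegenerate.prod hAn,
    (isTwoElementary_prod_iff _ _).2 ⟨IsTwoElementary.of_isUnimodular _ hu, hA2⟩,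
    (length_prod_eq_of_isUnimodular_left _ _ hu).trans hAℓ, ?_, ?_, fun h₁' h₂' h₃' ↦ ?_⟩
  · rw [signature_prod _ _ hs hAs, hσ, hAσ]
    ring
  · rw [Module.finrank_prod, finrank_pi_e8Form_prod_hyperbolicSum_carrier, hArk]
  · have hd := deltaInvariant_prod _ _ hu.nondegenerate hs he hAn hAs hAe
    rw [deltaInvariant_eq_zero_of_isUnimodular _ hu.nondegenerate hs he hu, hAδ, max_eq_right zero_le_one] at hd
    exact hd

/-- **`(r, a, δ, σ)(E₈(−1)^{⊕m} ⊕ U^{⊕n} ⊕ U(2)) = (8m + 2n + 2, 2, 0, −8m)`** (`U(2)` has `(r, a, δ) = (2, 2, 0)`,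
`σ = 0`); `m = 2`, `n = 1`: GHS's `U ⊕ 2E₈(−1) ⊕ U(2)`, the case `δ_{S_r} = 0`.
[cite: GritsenkoHulekSankaran2007Kodaira, §4 (arXiv numbering) Prop. 4.6 and its proof ("`U(2)` if `δ_{S_r} = 0`")] [cite: AlexeevNikulin2006, §9.2 ("`U` or `U(2)`"), §9.4.1] -/
theorem invariants_pi_neg_e8Form_prod_hyperbolicSum_prod_two_smul_hyperbolicSum :
    (((pi fun _ : Fin m ↦ -e8Form).prod (hyperbolicSum n)).prod ((2 : ℤ) • hyperbolicSum 1)).IsSymm ∧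
    (((pi fun _ : Fin m ↦ -e8Form).prod (hyperbolicSum n)).prod ((2 : ℤ) • hyperbolicSum 1)).IsEven ∧
    (((pi fun _ : Fin m ↦ -e8Form).prod (hyperbolicSum n)).prod ((2 : ℤ) • hyperbolicSum 1)).Nondegenerate ∧
    (((pi fun _ : Fin m ↦ -e8Form).prod (hyperbolicSum n)).prod ((2 : ℤ) • hyperbolicSum 1)).IsTwoElementary ∧
    (((pi fun _ : Fin m ↦ -e8Form).prod (hyperbolicSum n)).prod ((2 : ℤ) • hyperbolicSum 1)).length = 2 ∧
    (((pi fun _ : Fin m ↦ -e8Form).prod (hyperbolicSum n)).prod ((2 : ℤ) • hyperbolicSum 1)).signature = -(8 * m) ∧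
    finrank ℤ (((Fin m → Fin 8 → ℤ) × ((Fin n → ℤ) × (Fin n → ℤ))) × ((Fin 1 → ℤ) × (Fin 1 → ℤ))) =
      8 * m + 2 * n + 2 ∧
    ∀ (h₁ : (((pi fun _ : Fin m ↦ -e8Form).prod (hyperbolicSum n)).prod ((2 : ℤ) • hyperbolicSum 1)).Nondegenerate)
      (h₂ : (((pi fun _ : Fin m ↦ -e8Form).prod (hyperbolicSum n)).prod ((2 : ℤ) • hyperbolicSum 1)).IsSymm)
      (h₃ : (((pi fun _ : Fin m ↦ -e8Form).prod (hyperbolicSum n)).prod ((2 : ℤ) • hyperbolicSum 1)).IsEven),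
      (((pi fun _ : Fin m ↦ -e8Form).prod (hyperbolicSum n)).prod
        ((2 : ℤ) • hyperbolicSum 1)).deltaInvariant h₁ h₂ h₃ = 0 := by
  obtain ⟨hs, he, hu, hσ⟩ := pi_neg_e8Form_prod_hyperbolicSum_invariants m n
  obtain ⟨hAs, hAe, hAn⟩ := isSymm_isEven_nondegenerate_two_smul_hyperbolicSum 1
  obtain ⟨hArk, hA2, hAℓ, hAδ, hAσ⟩ := invariants_two_smul_hyperbolicSum 1 hAn hAs hAe
  refine ⟨hs.prod hAs, isEven_prod_iff.2 ⟨he, hAe⟩, hu.nondegenerate.prod hAn,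
    (isTwoElementary_prod_iff _ _).2 ⟨IsTwoElementary.of_isUnimodular _ hu, hA2⟩,
    (length_prod_eq_of_isUnimodular_left _ _ hu).trans hAℓ, ?_, ?_, fun h₁' h₂' h₃' ↦ ?_⟩
  · rw [signature_prod _ _ hs hAs, hσ, hAσ, add_zero]
  · rw [Module.finrank_prod, finrank_pi_e8Form_prod_hyperbolicSum_carrier, hArk]
  · have hd := deltaInvariant_prod _ _ hu.nondegenerate hs he hAn hAs hAe
    rw [deltaInvariant_eq_zero_of_isUnimodular _ hu.nondegenerate hs he hu, hAδ, max_self] at hd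
    exact hd

end Models

/-! ### §5 Proposition 4.6: `L_r` for `Λ` of rank `22` and signature `−16` (`L_{K3}`) -/

section Prop46

/-- **The invariants of `L_r` in the K3 case.** For an even unimodular `Λ` of rank `22` and signature `−16`
(`L_{K3}`; signature `(3, 19)`), `ℓ` primitive with `ℓ² = 2d > 0`, `r ⊥ ℓ` primitive with `r² = −2d` and
`d ∣ (r, ℓ^⊥)`: `L_r = {ℓ, r}^⊥` is nondegenerate, even, `2`-elementary, of rank `20`, signature `−16`
(i.e. `(2, 18)`), with `ℓ(L_r) ∈ {0, 2}` and `ℓ(L_r) = 0 ⟺ div(r) = 2d`. [cite: GritsenkoHulekSankaran2007Kodaira, §4 (arXiv numbering) proof of Prop. 4.6] -/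
theorem invariants_restrict_orthogonal_span_pair_of_neg_vector (hs : B.IsSymm) (he : B.IsEven)
    (hu : B.IsUnimodular) (hrk : finrank ℤ M = 22) (hσ : B.signature = -16) {ℓ r : M} {d : ℤ} (hd : 0 < d)
    (hℓ : B ℓ ℓ = 2 * d) (hℓsat : ∀ (k : ℤ) (w : M), k ≠ 0 → k • w ∈ ℤ ∙ ℓ → w ∈ ℤ ∙ ℓ) (hrℓ : B r ℓ = 0)
    (hr : B r r = -(2 * d)) (hrsat : ∀ (k : ℤ) (w : M), k ≠ 0 → k • w ∈ ℤ ∙ r → w ∈ ℤ ∙ r)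
    (hdvd : ∀ w, B w ℓ = 0 → d ∣ B r w) :
    (B.restrict (B.orthogonal (Submodule.span ℤ {ℓ, r}))).Nondegenerate ∧
    (B.restrict (B.orthogonal (Submodule.span ℤ {ℓ, r}))).IsSymm ∧
    (B.restrict (B.orthogonal (Submodule.span ℤ {ℓ, r}))).IsEven ∧
    (B.restrict (B.orthogonal (Submodule.span ℤ {ℓ, r}))).IsTwoElementary ∧
    finrank ℤ (B.orthogonal (Submodule.span ℤ {ℓ, r})) = 20 ∧
    (B.restrict (B.orthogonal (Submodule.span ℤ {ℓ, r}))).signature = -16 ∧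
    ((B.restrict (B.orthogonal (Submodule.span ℤ {ℓ, r}))).length = 0 ∨
      (B.restrict (B.orthogonal (Submodule.span ℤ {ℓ, r}))).length = 2) ∧
    ((B.restrict (B.orthogonal (Submodule.span ℤ {ℓ, r}))).length = 0 ↔ ∀ w, B w ℓ = 0 → 2 * d ∣ B r w) := by
  have hnd := nondegenerate_restrict_orthogonal_span_pair_of_neg_vector B hs he hu hd hℓ hℓsat hrℓ hr hrsat hdvd
  have h2 := isTwoElementary_restrict_orthogonal_span_pair_of_neg_vector B hs he hu hd hℓ hℓsat hrℓ hr hrsat hdvd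
  have hrk' := finrank_orthogonal_span_pair_add_two B hs hd.ne' hℓ hrℓ hr hnd
  have hle := length_restrict_orthogonal_span_pair_le_two B hs he hu hd.ne' hℓ hrℓ hr hnd
  have hne := length_restrict_orthogonal_span_pair_ne_one B hs he hu hd hℓ hrℓ hr hnd h2
  refine ⟨hnd, hs.restrict _, isEven_restrict he _, h2, by omega,
    (signature_restrict_orthogonal_span_pair B hs hu hd hℓ hrℓ hr hnd).trans hσ, by omega,
    length_restrict_orthogonal_span_pair_eq_zero_iff B hs he hu hd hℓ hℓsat hrℓ hr hrsat hdvd⟩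

/-- **GHS Prop. 4.6, `div(r) = 2d`: `r^⊥_{L_{2d}} ≅ 2U ⊕ 2E₈(−1)`.** For an even unimodular `Λ` of rank `22` and
signature `−16` (the K3 lattice `L_{K3} = 3U ⊕ 2E₈(−1)`), `ℓ = h` primitive with `h² = 2d > 0` (so `ℓ^⊥` is
`L_{2d}`), and a primitive `r ∈ ℓ^⊥` with `r² = −2d` and `2d ∣ (r, w)` for all `w ∈ ℓ^⊥` (`div(r) = 2d`), the
lattice `L_r = r^⊥_{ℓ^⊥} = {ℓ, r}^⊥` is isometric to `2U ⊕ 2E₈(−1)` ("`L_r` and `S_r` are isomorphic to the unique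
unimodular lattices of signatures `(2,18)` and `(1,1)`"; here through Nikulin's uniqueness in the genus).
[cite: GritsenkoHulekSankaran2007Kodaira, §4 (arXiv numbering) Prop. 4.6 ("If `div(r) = 2d` then `r^⊥_{L_{2d}} ≅ 2U ⊕ 2E₈(−1)`")] [cite: Nikulin1980, Cor. 1.13.3, Thm. 3.6.2] [cite: Huybrechts2016K3, Ch. 14 Thm. 1.1, Thm. 1.5] -/
theorem restrict_orthogonal_span_pair_equivalent_of_two_mul_dvd (hs : B.IsSymm) (he : B.IsEven)
    (hu : B.IsUnimodular) (hrk : finrank ℤ M = 22) (hσ : B.signature = -16) {ℓ r : M} {d : ℤ} (hd : 0 < d)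
    (hℓ : B ℓ ℓ = 2 * d) (hℓsat : ∀ (k : ℤ) (w : M), k ≠ 0 → k • w ∈ ℤ ∙ ℓ → w ∈ ℤ ∙ ℓ) (hrℓ : B r ℓ = 0)
    (hr : B r r = -(2 * d)) (hrsat : ∀ (k : ℤ) (w : M), k ≠ 0 → k • w ∈ ℤ ∙ r → w ∈ ℤ ∙ r)
    (h2d : ∀ w, B w ℓ = 0 → 2 * d ∣ B r w) :
    (B.restrict (B.orthogonal (Submodule.span ℤ {ℓ, r}))).Equivalent
      ((pi fun _ : Fin 2 ↦ -e8Form).prod (hyperbolicSum 2)) := by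
  have hdvd : ∀ w, B w ℓ = 0 → d ∣ B r w := fun w hw ↦ (dvd_mul_left d 2).trans (h2d w hw)
  obtain ⟨hKn, hKs, hKe, hK2, hKrk, hKσ, -, hKℓ⟩ :=
    invariants_restrict_orthogonal_span_pair_of_neg_vector B hs he hu hrk hσ hd hℓ hℓsat hrℓ hr hrsat hdvd
  have hKℓ0 := hKℓ.2 h2d
  have hKu := (length_eq_zero_iff_isUnimodular _ hKn).1 hKℓ0
  have hKδ := deltaInvariant_eq_zero_of_isUnimodular _ hKn hKs hKe hKu
  -- the model
  obtain ⟨hMs, hMe, hMu, hMσ⟩ := pi_neg_e8Form_prod_hyperbolicSum_invariants 2 2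
  have hMn := hMu.nondegenerate
  obtain ⟨hMrk, hM2, hMℓ, hMδ, -⟩ := invariants_pi_neg_e8Form_prod_hyperbolicSum 2 2 hMn hMs hMe
  have hMind : ((pi fun _ : Fin 2 ↦ -e8Form).prod (hyperbolicSum 2)).IsIndefinite := by
    rw [isIndefinite_iff_abs_signature_lt_finrank hMs hMn.1, hMσ, hMrk]
    norm_num
  obtain ⟨φ, -, hφq⟩ := hK2.exists_isometry_of_invariants_eq _ _ hM2 hKn hKs hKe hMn hMs hMe (by rw [hKℓ0, hMℓ])
    (by rw [hKδ, hMδ]) (by rw [hKσ, hMσ]; norm_num)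
  exact equivalent_of_discriminantQuad_iso_of_isIndefinite_of_length_add_three_le _ _ hKn hKs hKe hMn hMs hMe
    (by rw [hKrk, hMrk]) (by rw [hKσ, hMσ]; norm_num) φ hφq hMind (by rw [hMℓ, hMrk]; norm_num)

/-- **GHS Prop. 4.6, `div(r) = d`: `r^⊥_{L_{2d}} ≅ U ⊕ 2E₈(−1) ⊕ ⟨2⟩ ⊕ ⟨−2⟩` or `≅ U ⊕ 2E₈(−1) ⊕ U(2)`.** For an even
unimodular `Λ` of rank `22` and signature `−16` (`L_{K3}`), `ℓ` primitive with `ℓ² = 2d > 0`, and a primitive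
`r ∈ ℓ^⊥` with `r² = −2d`, `d ∣ (r, w)` for all `w ∈ ℓ^⊥` but `2d ∤ (r, w)` for some such `w` (`div(r) = d`),
`L_r = {ℓ, r}^⊥` is isometric to `U ⊕ 2E₈(−1) ⊕ ⟨2⟩ ⊕ ⟨−2⟩` (when `δ(L_r) = 1`) or to `U ⊕ 2E₈(−1) ⊕ U(2)` (when
`δ(L_r) = 0`): both sides are even indefinite `2`-elementary lattices with `(r, a, σ) = (20, 2, −16)` and the same
`δ`, so Nikulin's Thm. 3.6.2 (discriminant forms) and Cor. 1.13.3 (uniqueness in the genus, `rk ≥ ℓ + 3`) apply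
("The class of the indefinite lattice `L_r` is uniquely defined by its discriminant form").
[cite: GritsenkoHulekSankaran2007Kodaira, §4 (arXiv numbering) Prop. 4.6 ("If `div(r) = d` then either `r^⊥_{L_{2d}} ≅ U ⊕ 2E₈(−1) ⊕ ⟨2⟩ ⊕ ⟨−2⟩` or `r^⊥_{L_{2d}} ≅ U ⊕ 2E₈(−1) ⊕ U(2)`")] [cite: Nikulin1980, Cor. 1.13.3, Thm. 3.6.2] [cite: Huybrechts2016K3, Ch. 14 Thm. 1.5, Rem. 1.6] -/
theorem restrict_orthogonal_span_pair_equivalent_or_of_not_two_mul_dvd (hs : B.IsSymm) (he : B.IsEven)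
    (hu : B.IsUnimodular) (hrk : finrank ℤ M = 22) (hσ : B.signature = -16) {ℓ r : M} {d : ℤ} (hd : 0 < d)
    (hℓ : B ℓ ℓ = 2 * d) (hℓsat : ∀ (k : ℤ) (w : M), k ≠ 0 → k • w ∈ ℤ ∙ ℓ → w ∈ ℤ ∙ ℓ) (hrℓ : B r ℓ = 0)
    (hr : B r r = -(2 * d)) (hrsat : ∀ (k : ℤ) (w : M), k ≠ 0 → k • w ∈ ℤ ∙ r → w ∈ ℤ ∙ r)
    (hdvd : ∀ w, B w ℓ = 0 → d ∣ B r w) (hndvd : ¬ ∀ w, B w ℓ = 0 → 2 * d ∣ B r w) :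
    (B.restrict (B.orthogonal (Submodule.span ℤ {ℓ, r}))).Equivalent
        (((pi fun _ : Fin 2 ↦ -e8Form).prod (hyperbolicSum 1)).prod
          (BilinForm.prod ((2 : ℤ) • ((1 : ℤ) • LinearMap.mul ℤ ℤ)) ((2 : ℤ) • ((-1 : ℤ) • LinearMap.mul ℤ ℤ)))) ∨
      (B.restrict (B.orthogonal (Submodule.span ℤ {ℓ, r}))).Equivalent
        (((pi fun _ : Fin 2 ↦ -e8Form).prod (hyperbolicSum 1)).prod ((2 : ℤ) • hyperbolicSum 1)) := by
  obtain ⟨hKn, hKs, hKe, hK2, hKrk, hKσ, hKℓ02, hKℓ⟩ :=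
    invariants_restrict_orthogonal_span_pair_of_neg_vector B hs he hu hrk hσ hd hℓ hℓsat hrℓ hr hrsat hdvd
  have hKℓ2 : (B.restrict (B.orthogonal (Submodule.span ℤ {ℓ, r}))).length = 2 := by
    rcases hKℓ02 with h | h
    · exact absurd (hKℓ.1 h) hndvd
    · exact h
  rcases (B.restrict (B.orthogonal (Submodule.span ℤ {ℓ, r}))).deltaInvariant_eq_zero_or_eq_one hKn hKs hKe
    with hKδ | hKδ
  · -- `δ = 0`: the model `U ⊕ 2E₈(−1) ⊕ U(2)`
    right
    obtain ⟨hMs, hMe, hMn, hM2, hMℓ, hMσ, hMrk, hMδ⟩ :=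
      invariants_pi_neg_e8Form_prod_hyperbolicSum_prod_two_smul_hyperbolicSum 2 1
    have hMind : (((pi fun _ : Fin 2 ↦ -e8Form).prod (hyperbolicSum 1)).prod
        ((2 : ℤ) • hyperbolicSum 1)).IsIndefinite := by
      rw [isIndefinite_iff_abs_signature_lt_finrank hMs hMn.1, hMσ, hMrk]
      norm_num
    obtain ⟨φ, -, hφq⟩ := hK2.exists_isometry_of_invariants_eq _ _ hM2 hKn hKs hKe hMn hMs hMe (by rw [hKℓ2, hMℓ])
      (by rw [hKδ, hMδ hMn hMs hMe]) (by rw [hKσ, hMσ]; norm_num)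
    exact equivalent_of_discriminantQuad_iso_of_isIndefinite_of_length_add_three_le _ _ hKn hKs hKe hMn hMs hMe
      (by rw [hKrk, hMrk]) (by rw [hKσ, hMσ]; norm_num) φ hφq hMind (by rw [hMℓ, hMrk]; norm_num)
  · -- `δ = 1`: the model `U ⊕ 2E₈(−1) ⊕ ⟨2⟩ ⊕ ⟨−2⟩`
    left
    obtain ⟨hMs, hMe, hMn, hM2, hMℓ, hMσ, hMrk, hMδ⟩ := invariants_pi_neg_e8Form_prod_hyperbolicSum_prod_two_negTwo 2 1
    have hMind : (((pi fun _ : Fin 2 ↦ -e8Form).prod (hyperbolicSum 1)).prod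
        (BilinForm.prod ((2 : ℤ) • ((1 : ℤ) • LinearMap.mul ℤ ℤ)) ((2 : ℤ) • ((-1 : ℤ) • LinearMap.mul ℤ ℤ)))).IsIndefinite := by
      rw [isIndefinite_iff_abs_signature_lt_finrank hMs hMn.1, hMσ, hMrk]
      norm_num
    obtain ⟨φ, -, hφq⟩ := hK2.exists_isometry_of_invariants_eq _ _ hM2 hKn hKs hKe hMn hMs hMe (by rw [hKℓ2, hMℓ])
      (by rw [hKδ, hMδ hMn hMs hMe]) (by rw [hKσ, hMσ]; norm_num)
    exact equivalent_of_discriminantQuad_iso_of_isIndefinite_of_length_add_three_le _ _ hKn hKs hKe hMn hMs hMe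
      (by rw [hKrk, hMrk]) (by rw [hKσ, hMσ]; norm_num) φ hφq hMind (by rw [hMℓ, hMrk]; norm_num)

/-- **The two alternatives of Prop. 4.6 (`div(r) = d`) are told apart by `δ(L_r)`** ("`S_r ≅ U(2)` if `δ_{S_r} = 0`,
`⟨2⟩ ⊕ ⟨−2⟩` if `δ_{S_r} = 1`", and `δ(L_r) = δ(S_r)`): `δ(L_r) = 1 ⟹ L_r ≅ U ⊕ 2E₈(−1) ⊕ ⟨2⟩ ⊕ ⟨−2⟩` and
`δ(L_r) = 0 ⟹ L_r ≅ U ⊕ 2E₈(−1) ⊕ U(2)`. [cite: GritsenkoHulekSankaran2007Kodaira, §4 (arXiv numbering) proof of Prop. 4.6 ("`S_r ≅ U(2)` if `δ_{S_r} = 0`, `⟨2⟩ ⊕ ⟨−2⟩` if `δ_{S_r} = 1`")] [cite: Nikulin1980, Cor. 1.13.3, Thm. 3.6.2] -/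
theorem restrict_orthogonal_span_pair_equivalent_of_deltaInvariant (hs : B.IsSymm) (he : B.IsEven)
    (hu : B.IsUnimodular) (hrk : finrank ℤ M = 22) (hσ : B.signature = -16) {ℓ r : M} {d : ℤ} (hd : 0 < d)
    (hℓ : B ℓ ℓ = 2 * d) (hℓsat : ∀ (k : ℤ) (w : M), k ≠ 0 → k • w ∈ ℤ ∙ ℓ → w ∈ ℤ ∙ ℓ) (hrℓ : B r ℓ = 0)
    (hr : B r r = -(2 * d)) (hrsat : ∀ (k : ℤ) (w : M), k ≠ 0 → k • w ∈ ℤ ∙ r → w ∈ ℤ ∙ r)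
    (hdvd : ∀ w, B w ℓ = 0 → d ∣ B r w) (hndvd : ¬ ∀ w, B w ℓ = 0 → 2 * d ∣ B r w) :
    (∀ h₁ h₂ h₃, (B.restrict (B.orthogonal (Submodule.span ℤ {ℓ, r}))).deltaInvariant h₁ h₂ h₃ = 1 →
      (B.restrict (B.orthogonal (Submodule.span ℤ {ℓ, r}))).Equivalent
        (((pi fun _ : Fin 2 ↦ -e8Form).prod (hyperbolicSum 1)).prod
          (BilinForm.prod ((2 : ℤ) • ((1 : ℤ) • LinearMap.mul ℤ ℤ)) ((2 : ℤ) • ((-1 : ℤ) • LinearMap.mul ℤ ℤ))))) ∧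
    (∀ h₁ h₂ h₃, (B.restrict (B.orthogonal (Submodule.span ℤ {ℓ, r}))).deltaInvariant h₁ h₂ h₃ = 0 →
      (B.restrict (B.orthogonal (Submodule.span ℤ {ℓ, r}))).Equivalent
        (((pi fun _ : Fin 2 ↦ -e8Form).prod (hyperbolicSum 1)).prod ((2 : ℤ) • hyperbolicSum 1))) := by
  obtain ⟨hKn, hKs, hKe, hK2, hKrk, hKσ, hKℓ02, hKℓ⟩ :=
    invariants_restrict_orthogonal_span_pair_of_neg_vector B hs he hu hrk hσ hd hℓ hℓsat hrℓ hr hrsat hdvd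
  have hKℓ2 : (B.restrict (B.orthogonal (Submodule.span ℤ {ℓ, r}))).length = 2 := by
    rcases hKℓ02 with h | h
    · exact absurd (hKℓ.1 h) hndvd
    · exact h
  constructor
  · intro h₁ h₂ h₃ hKδ
    obtain ⟨hMs, hMe, hMn, hM2, hMℓ, hMσ, hMrk, hMδ⟩ := invariants_pi_neg_e8Form_prod_hyperbolicSum_prod_two_negTwo 2 1
    have hMind : (((pi fun _ : Fin 2 ↦ -e8Form).prod (hyperbolicSum 1)).prod
        (BilinForm.prod ((2 : ℤ) • ((1 : ℤ) • LinearMap.mul ℤ ℤ)) ((2 : ℤ) • ((-1 : ℤ) • LinearMap.mul ℤ ℤ)))).IsIndefinite := by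
      rw [isIndefinite_iff_abs_signature_lt_finrank hMs hMn.1, hMσ, hMrk]
      norm_num
    obtain ⟨φ, -, hφq⟩ := hK2.exists_isometry_of_invariants_eq _ _ hM2 h₁ h₂ h₃ hMn hMs hMe (by rw [hKℓ2, hMℓ])
      (by rw [hKδ, hMδ hMn hMs hMe]) (by rw [hKσ, hMσ]; norm_num)
    exact equivalent_of_discriminantQuad_iso_of_isIndefinite_of_length_add_three_le _ _ h₁ h₂ h₃ hMn hMs hMe
      (by rw [hKrk, hMrk]) (by rw [hKσ, hMσ]; norm_num) φ hφq hMind (by rw [hMℓ, hMrk]; norm_num)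
  · intro h₁ h₂ h₃ hKδ
    obtain ⟨hMs, hMe, hMn, hM2, hMℓ, hMσ, hMrk, hMδ⟩ :=
      invariants_pi_neg_e8Form_prod_hyperbolicSum_prod_two_smul_hyperbolicSum 2 1
    have hMind : (((pi fun _ : Fin 2 ↦ -e8Form).prod (hyperbolicSum 1)).prod
        ((2 : ℤ) • hyperbolicSum 1)).IsIndefinite := by
      rw [isIndefinite_iff_abs_signature_lt_finrank hMs hMn.1, hMσ, hMrk]
      norm_num
    obtain ⟨φ, -, hφq⟩ := hK2.exists_isometry_of_invariants_eq _ _ hM2 h₁ h₂ h₃ hMn hMs hMe (by rw [hKℓ2, hMℓ])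
      (by rw [hKδ, hMδ hMn hMs hMe]) (by rw [hKσ, hMσ]; norm_num)
    exact equivalent_of_discriminantQuad_iso_of_isIndefinite_of_length_add_three_le _ _ h₁ h₂ h₃ hMn hMs hMe
      (by rw [hKrk, hMrk]) (by rw [hKσ, hMσ]; norm_num) φ hφq hMind (by rw [hMℓ, hMrk]; norm_num)

end Prop46

end Literature.Topology.FourManifolds
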